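import Summits.BirchSwinnertonDyer.BirchSwinnertonDyer.Theorems.RamifiedSevenEllipticUnitsIndexIffControl
import Summits.BirchSwinnertonDyer.Rank1Residual.X12.CMSevenAwayFromSeven
import Summits.BirchSwinnertonDyer.Rank1Residual.X12.CMRamifiedAdditive
import Summits.BirchSwinnertonDyer.Rank1Residual.X12.CMTwoTorsion
import Summits.BirchSwinnertonDyer.Rank1Residual.Additive.AdditiveTorsionFiveSeven
import Summits.BirchSwinnertonDyer.Rank1Residual.Additive.StrictSelmerIndex
import Literature.NumberTheory.EllipticCurves.ZpExtensionAnticyclotomicHoldsProofs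
import Literature.NumberTheory.EllipticCurves.BSDSelmerParityDokchitserTowerProofs
import Literature.NumberTheory.EllipticCurves.HeegnerPointsImaginaryQuadraticProofs
import Literature.NumberTheory.EllipticCurves.GlobalMinimalModelProofs
import Literature.NumberTheory.EllipticCurves.StrictSelmerRankOne
import Literature.NumberTheory.QuadraticFields.FundamentalDiscriminant
import Literature.NumberTheory.Automorphic.ReciprocityGLnPatchingFamily
import HarnessLib

set_option linter.dupNamespace false
set_option autoImplicit false

/-!
# Route `RamifiedSevenEllipticUnits` (rung K7r): the support item `FrameDataSeven`
# (stmt-BirchSwinnertonDyer-19146) holds GIVEN Gross–Zagier–Kolyvagin — everything else in it is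
# a construction the tree already has

Cell `bsd-cm`, seat `bsd-cm-ram` (g5). HONEST READING of the item. `FrameDataSeven` asks, for every
globally minimal `W ∈ 𝒞₇`, for: the CM field `K = ℚ(√−7)` with a prime `𝔭 ∋ 7`, a globally minimal
frame twin `W' ≅ W^{(−7)}` with `IsFrame W 7 K 𝔭 W' C` and `W ∼ W'`, an anticyclotomic
`ℤ_7`-extension `κ` of `K` with a topological generator `γ`, and for `W` AND `W'` a generator `P` of
`E(ℚ)` modulo torsion with its exact `7`-divisibility level `n` in `E(ℚ_7)` together with
`E(ℚ_7)[7] = 0`. All of this is CONSTRUCTED from tree theorems —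
`Quadratic.exists_numberField_discr_eq` (the field of discriminant `−7`), `hasGlobalMinimalModel_rat_holds`
(the twin), `RamifiedSevenEllipticUnits.isIsogenous_of_isFrame` (p409726; the isogeny),
`ZpExtension.exists_isAnticyclotomic_holds` + `exists_isTopGenerator` (the anticyclotomic tower —
unconditional in the tree), `exists_generator_of_mordellWeilRank_eq_one` (Mordell–Weil, discharged)
+ `exists_addMonoidHom_padicInt_apply_eq_zero_iff` + `StrictSha.exists_level_of_not_isOfFinAddOrder`
(the level), and Mazur's local step `Additive.eq_zero_of_prime_nsmul_eq_zero_of_addv` (`E(ℚ_7)[7] = 0`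
at the additive prime `7`, whose side condition `v₇(c₆) ≠ 1` is FORCED by `j ∈ {−3375, 255³}`:
`c₄³ = jΔ`, `c₆² = (j − 1728)Δ` with `v₇(j) = 0`, `v₇(j − 1728) = 1` give `2v₇(c₆) = 1 + 3v₇(c₄)`,
so `v₇(c₆) ≡ 2 (mod 3)`) — EXCEPT ONE input: `rank_ℤ E(ℚ) = 1`, which the closed item can only get
from `r_an = 1` (a conjunct of `ClassCSeven`) through Gross–Zagier–Kolyvagin
(`rank_eq_analyticRank_of_analyticRank_le_one`, a published named fact, NOT a tree theorem; it is
already a conjunct of the route's `PublishedFactsSeven`). Hence: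

* `frameDataSeven_of_GZK : rank_eq_analyticRank_of_analyticRank_le_one → FrameDataSeven` (PROVED).

So the item is closable exactly modulo GZK: either the planner restates it as
`rank_eq_analyticRank_of_analyticRank_le_one → (frame data)` (closed by this theorem verbatim), or it
stays a conditional-result on that one named fact. Nothing is asserted; no named fact is minted.

References: [SilvermanAEC2009] VII.6.3, VIII.6.7; [Mazur1977] III.5 Step 1; [Washington1997] Thm 13.4;
[Darmon2004] Thm 3.22 (GZK); [SilvermanATAEC1994] App. A §3.
-/

noncomputable section

open scoped Classical

open WeierstrassCurve NumberField IsDedekindDomain Field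
  Literature.NumberTheory.EllipticCurves
  Literature.NumberTheory.EllipticCurves.Rank1Residual
  Summit.BirchSwinnertonDyer.Rank1Residual.X12.O11

namespace Summit.BirchSwinnertonDyer.BirchSwinnertonDyer.Theorems.RamifiedSevenEllipticUnits

/-! ## §1 Local input at `7`: `v₇(c₆) ≢ 1` for every curve with CM by `ℚ(√−7)` -/

/-- `ord₇ 5103 = 1` (`5103 = 7 · 3⁶`). [folklore] -/
theorem padicValNat_seven_5103 : padicValNat 7 5103 = 1 := by
  haveI : Fact (Nat.Prime 7) := ⟨by norm_num⟩
  rw [show (5103 : ℕ) = 7 * 729 by norm_num, padicValNat.mul (by norm_num) (by norm_num),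
    padicValNat.self (by norm_num), padicValNat.eq_zero_of_not_dvd (by norm_num)]

/-- `ord₇ 16579647 = 1` (`16579647 = 255³ − 1728 = 7 · 3⁸ · 19²`). [folklore] -/
theorem padicValNat_seven_16579647 : padicValNat 7 16579647 = 1 := by
  haveI : Fact (Nat.Prime 7) := ⟨by norm_num⟩
  rw [show (16579647 : ℕ) = 7 * 2368521 by norm_num, padicValNat.mul (by norm_num) (by norm_num),
    padicValNat.self (by norm_num), padicValNat.eq_zero_of_not_dvd (by norm_num)]

/-- `c₄³ = j · Δ` for an elliptic Weierstrass curve (`j = c₄³/Δ`). [folklore] -/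
theorem c₄_pow_three_eq_j_mul_Δ {F : Type*} [Field F] (V : WeierstrassCurve F) [V.IsElliptic] :
    V.c₄ ^ 3 = V.j * V.Δ := by
  have h1 : ((V.Δ'⁻¹ : Fˣ) : F) * V.Δ = 1 := by
    rw [← V.coe_Δ', Units.inv_mul]
  calc V.c₄ ^ 3 = (((V.Δ'⁻¹ : Fˣ) : F) * V.Δ) * V.c₄ ^ 3 := by rw [h1, one_mul]
    _ = V.j * V.Δ := by rw [WeierstrassCurve.j]; ring

/-- `c₆² = (j − 1728) · Δ` for an elliptic Weierstrass curve (`c₄³ − c₆² = 1728Δ`). [folklore] -/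
theorem c₆_sq_eq_j_sub_mul_Δ {F : Type*} [Field F] (V : WeierstrassCurve F) [V.IsElliptic] :
    V.c₆ ^ 2 = (V.j - 1728) * V.Δ := by
  have h := V.c_relation
  have h3 := c₄_pow_three_eq_j_mul_Δ V
  linear_combination h + h3

/-- **`v₇(c₆(E)) ≠ 1` for every elliptic curve over `ℚ` with CM field `ℚ(√−7)`** (any model):
`j(E) ∈ {−3375, 16581375}`, and `c₄³ = jΔ`, `c₆² = (j − 1728)Δ` with `7 ∤ j`, `7 ∥ (j − 1728)`
(`−3375 − 1728 = −7·3⁶`, `16581375 − 1728 = 7·3⁸·19²`) give `3 v₇(c₄) = v₇(Δ)` and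
`2 v₇(c₆) = 1 + v₇(Δ)`, so `v₇(c₆) = 1` would force `3 v₇(c₄) = 1`. This is Mazur's exceptional
locus `v₇(c₆) = 1` (Kodaira II at `7`) being EMPTY on the CM-by-`√−7` class.
[cite: Mazur1977, Ch. III §5, Step 1, p. 158] [cite: SilvermanATAEC1994, App. A §3] -/
theorem padicValRat_seven_c₆_ne_one (W : WeierstrassCurve ℚ) [W.IsElliptic]
    (hj : cmFieldDiscrOfJ W.j = -7) : padicValRat 7 W.c₆ ≠ 1 := by
  haveI : Fact (Nat.Prime 7) := ⟨by norm_num⟩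
  have hΔ : W.Δ ≠ 0 := W.Δ'.ne_zero
  have h3 := c₄_pow_three_eq_j_mul_Δ W
  have h2 := c₆_sq_eq_j_sub_mul_Δ W
  intro h1
  rcases Summit.BirchSwinnertonDyer.Rank1Residual.X12.j_eq_of_cmFieldDiscrOfJ_eq_neg_seven hj
    with hj' | hj'
  · -- `j = -3375`: `c₄³ = -3375 Δ`, `c₆² = -5103 Δ`
    rw [hj'] at h3 h2
    norm_num at h2
    have hc4 : W.c₄ ≠ 0 := by
      intro h0; rw [h0] at h3; norm_num at h3; exact hΔ h3
    have hc6 : W.c₆ ≠ 0 := by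
      intro h0; rw [h0] at h2; norm_num at h2; exact hΔ h2
    have v3 := congrArg (padicValRat 7) h3
    have v2 := congrArg (padicValRat 7) h2
    rw [padicValRat.pow W.c₄, padicValRat.mul (by norm_num) hΔ,
      show ((-3375 : ℚ)) = -((3375 : ℕ) : ℚ) by norm_num, padicValRat.neg, padicValRat.of_nat,
      padicValNat.eq_zero_of_not_dvd (by norm_num)] at v3
    rw [padicValRat.pow W.c₆, show (-(5103 * W.Δ) : ℚ) = (-((5103 : ℕ) : ℚ)) * W.Δ by push_cast; ring,
      padicValRat.mul (by norm_num) hΔ, padicValRat.neg, padicValRat.of_nat,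
      padicValNat_seven_5103] at v2
    rw [h1] at v2
    push_cast at v3 v2
    omega
  · -- `j = 16581375`: `c₄³ = 16581375 Δ`, `c₆² = 16579647 Δ`
    rw [hj'] at h3 h2
    norm_num at h2
    have hc4 : W.c₄ ≠ 0 := by
      intro h0; rw [h0] at h3; norm_num at h3; exact hΔ h3
    have hc6 : W.c₆ ≠ 0 := by
      intro h0; rw [h0] at h2; norm_num at h2; exact hΔ h2
    have v3 := congrArg (padicValRat 7) h3
    have v2 := congrArg (padicValRat 7) h2
    rw [padicValRat.pow W.c₄, padicValRat.mul (by norm_num) hΔ,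
      show ((16581375 : ℚ)) = ((16581375 : ℕ) : ℚ) by norm_num, padicValRat.of_nat,
      padicValNat.eq_zero_of_not_dvd (by norm_num)] at v3
    rw [padicValRat.pow W.c₆, show ((16579647 : ℚ)) = ((16579647 : ℕ) : ℚ) by norm_num,
      padicValRat.mul (by norm_num) hΔ, padicValRat.of_nat, padicValNat_seven_16579647] at v2
    rw [h1] at v2
    push_cast at v3 v2
    omega

/-- **`E(ℚ_7)[7] = 0` for every globally minimal `E/ℚ` with CM field `ℚ(√−7)`**: `7` is ramified in
the CM field, so additive for `E` (`X12.addv_of_hasCM_of_cmRamified`), and Mazur's local step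
(`Additive.eq_zero_of_prime_nsmul_eq_zero_of_addv`) applies because the exceptional locus
`v₇(c₆) = 1` is empty (`padicValRat_seven_c₆_ne_one`). [cite: Mazur1977, Ch. III §5, Step 1, p. 158] -/
theorem seven_nsmul_eq_zero_padic (W : WeierstrassCurve ℚ) [W.IsElliptic] [W.IsGloballyMinimal]
    [Fact (Nat.Prime 7)] (hCM : W.HasCM) (hj : cmFieldDiscrOfJ W.j = -7)
    (Q : (W.baseChange ℚ_[7]).toAffine.Point) (hQ : 7 • Q = 0) : Q = 0 := by
  have hram : CMRamified W 7 := by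
    change ((7 : ℕ) : ℤ) ∣ cmFieldDiscrOfJ W.j
    rw [hj]; norm_num
  have hadd : Addv W 7 :=
    Summit.BirchSwinnertonDyer.Rank1Residual.X12.addv_of_hasCM_of_cmRamified W 7 hCM (by norm_num) hram
  exact Summit.BirchSwinnertonDyer.Rank1Residual.Additive.eq_zero_of_prime_nsmul_eq_zero_of_addv W 7
    (by norm_num) hadd (fun h => by norm_num at h) (fun _ => padicValRat_seven_c₆_ne_one W hj) hQ

/-! ## §2 Bookkeeping input: Mordell–Weil data with its level (a prime of `𝓞_K` above `7` is the
tree's `PatchingFamily.exists_heightOneSpectrum_natCast_mem`) -/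

/-- **Mordell–Weil data with its level**, for a curve of rank one with `E(ℚ_p)[p] = 0` replaced by
nothing (the level exists for any non-torsion point): a generator `P` of `E(ℚ)` modulo torsion
(Mordell–Weil, discharged in the tree) and its exact `p`-divisibility level `n` in `E(ℚ_p)`
(AEC VII.6.3: a `λ : E(ℚ_p) → ℤ_p` vanishing exactly on torsion bounds the levels).
[cite: SilvermanAEC2009, Prop. VII.6.3 and Thm. VIII.6.7] -/
theorem exists_generator_with_level (W : WeierstrassCurve ℚ) [W.IsElliptic] (p : ℕ) [Fact p.Prime]
    (hrank : W.mordellWeilRank = 1) :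
    ∃ (P : W.toAffine.Point) (n : ℕ), ¬ IsOfFinAddOrder P ∧
      (∀ R : W.toAffine.Point, ∃ (k : ℤ) (T : W.toAffine.Point), IsOfFinAddOrder T ∧ R = k • P + T) ∧
      (∃ Q : (W.baseChange ℚ_[p]).toAffine.Point, p ^ n • Q = W.toPadicPoint p P) ∧
      (∀ Q : (W.baseChange ℚ_[p]).toAffine.Point, p ^ (n + 1) • Q ≠ W.toPadicPoint p P) := by
  obtain ⟨P, hP, hgen⟩ := exists_generator_of_mordellWeilRank_eq_one W hrank
  obtain ⟨lam, hlam⟩ := exists_addMonoidHom_padicInt_apply_eq_zero_iff p (W.baseChange ℚ_[p])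
  have hinj : Function.Injective (W.toPadicPoint p) :=
    Affine.Point.map_injective (W' := W) (Algebra.ofId ℚ ℚ_[p])
  have hP' : ¬ IsOfFinAddOrder P := by convert hP
  have hPp : ¬ IsOfFinAddOrder (W.toPadicPoint p P) := by
    intro h
    apply hP'
    obtain ⟨m, hm, hmP⟩ := isOfFinAddOrder_iff_nsmul_eq_zero.mp h
    refine isOfFinAddOrder_iff_nsmul_eq_zero.mpr ⟨m, hm, hinj ?_⟩
    rw [map_nsmul, map_zero]
    exact hmP
  obtain ⟨n, hdiv, hndiv⟩ :=
    Summit.BirchSwinnertonDyer.Rank1Residual.Additive.StrictSha.exists_level_of_not_isOfFinAddOrder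
      p lam hlam hPp
  refine ⟨P, n, hP', fun R => ?_, hdiv, hndiv⟩
  obtain ⟨a, t, ht, hR⟩ := hgen R
  exact ⟨a, t, by convert ht, by convert hR⟩

/-! ## §3 `FrameDataSeven` from Gross–Zagier–Kolyvagin -/

/-- **`FrameDataSeven` (stmt-BirchSwinnertonDyer-19146) holds granted GZK.** For every globally
minimal `W ∈ 𝒞₇`: `K = ℚ(√−7)` (`Quadratic.exists_numberField_discr_eq` at the fundamental
discriminant `−7`; imaginary quadratic as `d_K < 0`) with a prime `𝔭 ∋ 7`; the frame twin
`W' = C • W^{(−7)}` globally minimal (`hasGlobalMinimalModel_rat_holds`), so `IsFrame W 7 K 𝔭 W' C`,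
and `W ∼ W'` (`isIsogenous_of_isFrame`); an anticyclotomic `ℤ_7`-extension of `K`
(`ZpExtension.exists_isAnticyclotomic_holds`) with a topological generator; and for `W`, `W'` the
Mordell–Weil generator with its level (`exists_generator_with_level`, rank one for `W'` by isogeny
invariance of the analytic rank) and `E(ℚ_7)[7] = 0` (`seven_nsmul_eq_zero_padic`; `W'` has the same
`j`, hence the same CM field). The ONLY non-constructive input is `rank_ℤ = r_an = 1`, i.e. GZK
(`hGZK`). [cite: Darmon2004, Thm. 3.22 (= Thm. 1.14) and §3.9]
[cite: SilvermanAEC2009, Prop. VII.6.3 and Thm. VIII.6.7] [cite: Washington1997, Thm. 13.4] -/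
theorem frameDataSeven_of_GZK (hGZK : rank_eq_analyticRank_of_analyticRank_le_one) :
    Summit.BirchSwinnertonDyer.BirchSwinnertonDyer.Theses.RamifiedSevenEllipticUnits.FrameDataSeven := by
  intro W _ _ _ hW
  obtain ⟨hCM, hj, hr, -, -⟩ := hW
  -- the CM field `K = ℚ(√−7)` and a prime above `7`
  obtain ⟨K, _, _, h2, hdK⟩ :=
    Literature.NumberTheory.QuadraticFields.Quadratic.exists_numberField_discr_eq (D := -7)
      (Or.inl ⟨by norm_num, by
        rw [← Int.squarefree_natAbs]
        exact (Nat.prime_iff.mp (by norm_num : Nat.Prime 7)).squarefree, by norm_num⟩)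
  have hK : IsImaginaryQuadratic K :=
    isImaginaryQuadratic_iff_discr_neg.mpr ⟨h2, by rw [hdK]; norm_num⟩
  obtain ⟨𝔭, h𝔭⟩ :=
    Literature.NumberTheory.Automorphic.PatchingFamily.exists_heightOneSpectrum_natCast_mem K
      (p := 7) (by norm_num)
  -- the frame twin
  have hd0 : ((cmFieldDiscrOfJ W.j : ℤ) : ℚ) ≠ 0 := by rw [hj]; norm_num
  haveI := W.isElliptic_quadraticTwist hd0
  obtain ⟨C, hC⟩ := hasGlobalMinimalModel_rat_holds (W.quadraticTwist ((cmFieldDiscrOfJ W.j : ℤ) : ℚ))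
  haveI := hC
  have hF : IsFrame W 7 K 𝔭 (C • W.quadraticTwist ((cmFieldDiscrOfJ W.j : ℤ) : ℚ)) C := by
    refine ⟨hCM, ?_, by norm_num, hK, by rw [hdK, hj], h𝔭, rfl⟩
    change ((7 : ℕ) : ℤ) ∣ cmFieldDiscrOfJ W.j
    rw [hj]; norm_num
  set W' := C • W.quadraticTwist ((cmFieldDiscrOfJ W.j : ℤ) : ℚ) with hW'
  have hiso : IsIsogenous W W' := isIsogenous_of_isFrame hF
  -- the anticyclotomic `ℤ_7`-extension and a topological generator
  obtain ⟨κ, hκ⟩ := ZpExtension.exists_isAnticyclotomic_holds (K := K) (p := 7) h2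
    (fun w => hK.2.isComplex w)
  obtain ⟨γ, hγ⟩ := κ.exists_isTopGenerator
  -- Mordell–Weil data and levels for `W` and `W'` (GZK gives rank one)
  have hrank : W.mordellWeilRank = 1 := by rw [(hGZK W hr.le).1, hr]
  have hr' : W'.analyticRank = 1 := by rw [← analyticRank_eq_of_isIsogenous' hiso, hr]
  have hrank' : W'.mordellWeilRank = 1 := by rw [(hGZK W' hr'.le).1, hr']
  obtain ⟨P, n, hP, hgen, hdiv, hndiv⟩ := exists_generator_with_level W 7 hrank
  obtain ⟨P', n', hP', hgen', hdiv', hndiv'⟩ := exists_generator_with_level W' 7 hrank'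
  -- no `7`-torsion in `E(ℚ_7)` for `W` and `W'`
  have hCM' : W'.HasCM := Summit.BirchSwinnertonDyer.Rank1Residual.X12.hasCM_of_isIsogenous hiso hCM
  have hj' : cmFieldDiscrOfJ W'.j = -7 := by
    rw [← Summit.BirchSwinnertonDyer.Rank1Residual.X12.cmFieldDiscrOfJ_eq_of_isIsogenous hiso hCM, hj]
  exact ⟨K, inferInstance, inferInstance, 𝔭, W', inferInstance, inferInstance, C, κ, γ, ⟨hγ⟩, P, n,
    P', n', hF, hiso, hκ, hP, hgen, seven_nsmul_eq_zero_padic W hCM hj, hdiv, hndiv, hP', hgen',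
    seven_nsmul_eq_zero_padic W' hCM' hj', hdiv', hndiv'⟩

end Summit.BirchSwinnertonDyer.BirchSwinnertonDyer.Theorems.RamifiedSevenEllipticUnits

end
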